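import Summits.MatrixMultiplication.OmegaCensus.BoxKeyLiftModel

/-!
# ω-census, family (b3): conjecture C9 (b) — the `D₁₈` CONFIGURATION (an element of order `9` inverted by another) is box-useless, ratio `≥ 2`

HONEST FRAMING (pub-omega census; verbatim): lottery ticket; floor = certified bounds/negative ranges.
Census BOOKKEEPING (conjecture C9 of the cell, STRUCTURE.md §2; pub-omega kernel-l4 gen 16, task K-5; fourth client of
`BoxKeyLiftModel`).

**Theorem (`D18Config.not_boxUseful`).** Let `a, s ∈ G` with `a⁹ = 1 ≠ a³` and `s a s⁻¹ = a⁻¹` (NOTHING is assumed on the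
order of `s`; `s²` merely centralises `a`).  Then `G` is NOT box-useful: the box `G × {1, a, a⁻¹s} × {1, a², a²s}` carries
`2|G|` independent cells — key lift over `N = ⟨a⟩ ≅ C₉` with an `18`-element pattern (`18/9 = 2`), found by the seat's exact
key-graph search and checked by `decide` in the model `Multiplicative (ZMod 9)`; the `81` gauge words by one simp normal form.
**Corollaries.** `D₁₈`, `Dic₉ = C₉ ⋊ C₄`, `C₉ ⋊ C₈`, `D₁₈ × A`, `Dih(C₉ × B)`, … — every group in which some element inverts an
element of order `9` (in RELATION form: no homomorphism onto `D₁₈` and no involution needed).  In the non-nilpotent analysis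
this is the endpoint 'an inverted `3`-element of order `> 3`'.  Nothing here is progress on `ω`.
-/

namespace Summit.MatrixMultiplication.OmegaCensus

open Finset ProductBoxBound KeyLift KleinRot

namespace D18Config

/-- The coordinate model `M = C₉` (multiplicative). [folklore] -/
abbrev M := Multiplicative (ZMod 9)

/-- Coordinate `v p = a^p` in the model. [folklore] -/
def v (p : ZMod 9) : M := Multiplicative.ofAdd p

/-- Conjugation by `s` in coordinates: inversion. [folklore] -/
def σs : M →* M where
  toFun m := m⁻¹
  map_one' := by decide
  map_mul' := by decide

/-- `σs` is an involution. [folklore] -/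
theorem σs_σs : ∀ m, σs (σs m) = m := by decide

/-- The gauge table of the box `{1, a, a⁻¹s} × {1, a², a²s}` in coordinates (machine-generated from the model). [folklore] -/
def γ : Three → Three → Three → Three → M
  | .i0, .i0, .i0, .i0 => v 0
  | .i0, .i0, .i0, .i1 => v 0
  | .i0, .i0, .i0, .i2 => v 0
  | .i0, .i0, .i1, .i0 => v 0
  | .i0, .i0, .i1, .i1 => v 0
  | .i0, .i0, .i1, .i2 => v 7
  | .i0, .i0, .i2, .i0 => v 0
  | .i0, .i0, .i2, .i1 => v 4
  | .i0, .i0, .i2, .i2 => v 6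
  | .i0, .i1, .i0, .i0 => v 0
  | .i0, .i1, .i0, .i1 => v 0
  | .i0, .i1, .i0, .i2 => v 4
  | .i0, .i1, .i1, .i0 => v 0
  | .i0, .i1, .i1, .i1 => v 0
  | .i0, .i1, .i1, .i2 => v 2
  | .i0, .i1, .i2, .i0 => v 0
  | .i0, .i1, .i2, .i1 => v 4
  | .i0, .i1, .i2, .i2 => v 1
  | .i0, .i2, .i0, .i0 => v 0
  | .i0, .i2, .i0, .i1 => v 5
  | .i0, .i2, .i0, .i2 => v 0
  | .i0, .i2, .i1, .i0 => v 0
  | .i0, .i2, .i1, .i1 => v 5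
  | .i0, .i2, .i1, .i2 => v 7
  | .i0, .i2, .i2, .i0 => v 0
  | .i0, .i2, .i2, .i1 => v 0
  | .i0, .i2, .i2, .i2 => v 6
  | .i1, .i0, .i0, .i0 => v 0
  | .i1, .i0, .i0, .i1 => v 0
  | .i1, .i0, .i0, .i2 => v 2
  | .i1, .i0, .i1, .i0 => v 0
  | .i1, .i0, .i1, .i1 => v 0
  | .i1, .i0, .i1, .i2 => v 0
  | .i1, .i0, .i2, .i0 => v 2
  | .i1, .i0, .i2, .i1 => v 6
  | .i1, .i0, .i2, .i2 => v 6
  | .i1, .i1, .i0, .i0 => v 0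
  | .i1, .i1, .i0, .i1 => v 0
  | .i1, .i1, .i0, .i2 => v 6
  | .i1, .i1, .i1, .i0 => v 0
  | .i1, .i1, .i1, .i1 => v 0
  | .i1, .i1, .i1, .i2 => v 4
  | .i1, .i1, .i2, .i0 => v 2
  | .i1, .i1, .i2, .i1 => v 6
  | .i1, .i1, .i2, .i2 => v 1
  | .i1, .i2, .i0, .i0 => v 0
  | .i1, .i2, .i0, .i1 => v 5
  | .i1, .i2, .i0, .i2 => v 2
  | .i1, .i2, .i1, .i0 => v 0
  | .i1, .i2, .i1, .i1 => v 5
  | .i1, .i2, .i1, .i2 => v 0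
  | .i1, .i2, .i2, .i0 => v 2
  | .i1, .i2, .i2, .i1 => v 2
  | .i1, .i2, .i2, .i2 => v 6
  | .i2, .i0, .i0, .i0 => v 0
  | .i2, .i0, .i0, .i1 => v 5
  | .i2, .i0, .i0, .i2 => v 3
  | .i2, .i0, .i1, .i0 => v 7
  | .i2, .i0, .i1, .i1 => v 3
  | .i2, .i0, .i1, .i2 => v 3
  | .i2, .i0, .i2, .i0 => v 0
  | .i2, .i0, .i2, .i1 => v 0
  | .i2, .i0, .i2, .i2 => v 0
  | .i2, .i1, .i0, .i0 => v 0
  | .i2, .i1, .i0, .i1 => v 5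
  | .i2, .i1, .i0, .i2 => v 8
  | .i2, .i1, .i1, .i0 => v 7
  | .i2, .i1, .i1, .i1 => v 3
  | .i2, .i1, .i1, .i2 => v 8
  | .i2, .i1, .i2, .i0 => v 0
  | .i2, .i1, .i2, .i1 => v 0
  | .i2, .i1, .i2, .i2 => v 5
  | .i2, .i2, .i0, .i0 => v 0
  | .i2, .i2, .i0, .i1 => v 0
  | .i2, .i2, .i0, .i2 => v 3
  | .i2, .i2, .i1, .i0 => v 7
  | .i2, .i2, .i1, .i1 => v 7
  | .i2, .i2, .i1, .i2 => v 3
  | .i2, .i2, .i2, .i0 => v 0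
  | .i2, .i2, .i2, .i1 => v 4
  | .i2, .i2, .i2, .i2 => v 0

/-- The `18`-element key pattern (machine-found; `18 = 2·|C₉|`). [folklore] -/
def T₀ : Finset (M × Three × Three) :=
  {(v 0, .i0, .i0), (v 1, .i0, .i0), (v 4, .i0, .i1), (v 5, .i0, .i1), (v 7, .i0, .i2), (v 2, .i1, .i0), (v 3, .i1, .i0), (v 6, .i1, .i1), (v 7, .i1, .i1), (v 6, .i1, .i2), (v 7, .i1, .i2), (v 3, .i2, .i0), (v 6, .i2, .i0), (v 2, .i2, .i1), (v 8, .i2, .i1), (v 2, .i2, .i2), (v 7, .i2, .i2), (v 8, .i2, .i2)}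

set_option maxRecDepth 4000 in
/-- The pattern is independent in the model key graph. [folklore] -/
theorem T₀_key : ∀ t ∈ T₀, ∀ t' ∈ T₀, t ≠ t' → t.1 ≠ γ t.2.1 t.2.2 t'.2.1 t'.2.2 * t'.1 := by decide

/-- `#T₀ = 18`. [folklore] -/
theorem T₀_card : #T₀ = 18 := by decide

/-- Values in `ZMod 9`. [folklore] -/ theorem val1 : (1 : ZMod 9).val = 1 := rfl
/-- Values in `ZMod 9`. [folklore] -/ theorem val2 : (2 : ZMod 9).val = 2 := rfl
/-- Values in `ZMod 9`. [folklore] -/ theorem val8 : (8 : ZMod 9).val = 8 := rfl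

variable {G : Type*} [Group G] {a s : G}

section Main

variable (ha : a ^ 9 = 1)

/-- The coordinate homomorphism `ψ p = a^p`. [folklore] -/
def ψ (ha : a ^ 9 = 1) : M →* G := cycHom 9 a ha

/-- `ψ (v p) = a ^ p.val`. [folklore] -/
theorem ψ_v (p : ZMod 9) : ψ ha (v p) = a ^ p.val := rfl

/-- `a⁻¹ = a⁸`. [folklore] -/
theorem inv_eq_pow8 (ha : a ^ 9 = 1) : a⁻¹ = a ^ 8 := by
  calc a⁻¹ = a⁻¹ * a ^ 9 := by rw [ha, mul_one]
    _ = a ^ 8 := by group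

/-- Conjugation by `s` in coordinates. [folklore] -/
theorem conj_s (hsa : s * a * s⁻¹ = a⁻¹) (m : M) : s * ψ ha m * s⁻¹ = ψ ha (σs m) := by
  refine conj_of_hom_eq (mzmod_ext ?_) m
  have e2 : σs (Multiplicative.ofAdd (1 : ZMod 9)) = v 8 := by decide
  have g1 : ψ ha (Multiplicative.ofAdd 1) = a := by rw [show Multiplicative.ofAdd (1 : ZMod 9) = v 1 from rfl, ψ_v, val1, pow_one]
  simp only [MonoidHom.comp_apply, MulEquiv.coe_toMonoidHom, MulAut.conj_apply, g1, e2, ψ_v, val8, hsa, inv_eq_pow8 ha]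

/-- `orderOf a = 9` from `a⁹ = 1 ≠ a³`. [folklore] -/
theorem orderOf_eq (ha : a ^ 9 = 1) (ha3 : a ^ 3 ≠ 1) : orderOf a = 9 := by
  have hdvd : orderOf a ∣ 9 := orderOf_dvd_of_pow_eq_one ha
  have h9 : (9 : ℕ) = 3 ^ 2 := by norm_num
  rw [h9, Nat.dvd_prime_pow Nat.prime_three] at hdvd
  obtain ⟨k, hk, hk'⟩ := hdvd
  interval_cases k
  · exfalso; apply ha3
    rw [pow_zero] at hk'
    rw [orderOf_eq_one_iff.mp hk', one_pow]
  · exfalso; apply ha3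
    rw [pow_one] at hk'
    rw [← hk', pow_orderOf_eq_one]
  · rw [hk']; norm_num

end Main

section Final

variable (ha : a ^ 9 = 1)

/-- The second box coordinate `Y = {1, a, a⁻¹s}` (`a⁻¹ = ψ (v 8)`). [folklore] -/
def yv (φ : M →* G) (s : G) : Three → G
  | .i0 => 1 | .i1 => φ (v 1) | .i2 => φ (v 8) * s

/-- The third box coordinate `W = {1, a², a²s}`. [folklore] -/
def wv (φ : M →* G) (s : G) : Three → G
  | .i0 => 1 | .i1 => φ (v 2) | .i2 => φ (v 2) * s

include ha in
/-- **The `D₁₈` configuration makes `G` box-useless (ratio `≥ 2`).** [folklore] -/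
theorem not_boxUseful [Fintype G] [DecidableEq G] (ha3 : a ^ 3 ≠ 1) (hsa : s * a * s⁻¹ = a⁻¹) : ¬ BoxUseful G := by
  classical
  have hinj : Function.Injective (ψ ha) := cycHom_injective 9 a ha (orderOf_eq ha ha3)
  have g0 : ψ ha (v 0) = 1 := by rw [ψ_v]; simp
  have Rs := conj_rule (conj_s ha hsa)
  have Rs' := conj_rule' (conj_s ha hsa)
  have Rsi := conj_rule_inv (conj_s ha hsa) σs_σs
  have Rsi' := conj_rule_inv' (conj_s ha hsa) σs_σs
  -- if `s` commuted with `a` we would have `a = a⁻¹`, `a² = 1`, `a = a⁹ (a²)⁻⁴ = 1`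
  have ha1 : a ≠ 1 := by rintro rfl; exact ha3 (one_pow 3)
  have key : ∀ g : G, g * a = a * g → s ≠ g := by
    rintro g hg rfl
    apply ha1
    have e : a⁻¹ = a := by rw [← hsa, hg, mul_inv_cancel_right]
    have h2 : a ^ 2 = 1 := by rw [pow_two]; nth_rw 1 [← e]; exact inv_mul_cancel a
    calc a = a ^ 9 * ((a ^ 2) ^ 4)⁻¹ := by group
      _ = 1 := by rw [ha, h2]; group
  have g1 : ψ ha (v 1) = a := by rw [ψ_v, val1, pow_one]
  have g2 : ψ ha (v 2) = a ^ 2 := by rw [ψ_v, val2]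
  have g8 : ψ ha (v 8) = a ^ 8 := by rw [ψ_v, val8]
  have ha2 : a ^ 2 ≠ 1 := by
    intro h2; apply ha1
    calc a = a ^ 9 * ((a ^ 2) ^ 4)⁻¹ := by group
      _ = 1 := by rw [ha, h2]; group
  have d1 : a ^ 8 * s ≠ 1 := fun h => key _ (by group) (eq_inv_of_mul_eq_one_right h)
  have d2 : a ≠ a ^ 8 * s := fun h => key ((a ^ 8)⁻¹ * a) (by group) (by
    calc s = (a ^ 8)⁻¹ * (a ^ 8 * s) := by group
      _ = (a ^ 8)⁻¹ * a := by rw [← h])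
  have d3 : a ^ 2 * s ≠ 1 := fun h => key _ (by group) (eq_inv_of_mul_eq_one_right h)
  have d4 : a ^ 2 ≠ a ^ 2 * s := fun h => key 1 (by group) (by
    have := h.symm; rw [mul_eq_left] at this; exact this)
  have hy_inj : Function.Injective (yv (ψ ha) s) := by
    intro i j h
    cases i <;> cases j <;> simp only [yv, g1, g8] at h
    all_goals first | rfl | exfalso
    all_goals first | exact ha1 h.symm | exact ha1 h | exact d1 h.symm | exact d1 h | exact d2 h | exact d2 h.symm
  have hw_inj : Function.Injective (wv (ψ ha) s) := by
    intro i j h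
    cases i <;> cases j <;> simp only [wv, g2] at h
    all_goals first | rfl | exfalso
    all_goals first | exact ha2 h.symm | exact ha2 h | exact d3 h.symm | exact d3 h | exact d4 h | exact d4 h.symm
  have hM : 9 * Fintype.card M ≤ 5 * #T₀ := by
    rw [T₀_card]; simp [M, ZMod.card]
  refine not_boxUseful_of_model (ψ ha) hinj (yv (ψ ha) s) (wv (ψ ha) s) hy_inj hw_inj rfl rfl γ ?_ T₀ T₀_key hM
  intro i j i' j'
  cases i <;> cases j <;> cases i' <;> cases j' <;>
  · simp only [yv, wv, γ, gaugeWord, mul_assoc, mul_inv_rev, inv_one, one_mul, mul_one, psi_mul_left, psi_mul,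
      psi_inv, Rs, Rs', Rsi, Rsi', mul_inv_cancel_left, mul_inv_cancel, map_one]
    first | exact g0.symm | (apply congrArg (ψ ha); decide)

end Final

end D18Config

end Summit.MatrixMultiplication.OmegaCensus
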